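import Literature.Analysis.FluidPDE.EulerReynolds
import Literature.Analysis.FluidPDE.PressurePoisson
import HarnessLib

/-!
# The pressure equation of a classical Euler–Reynolds solution on the torus, lifted to `ℝ^d`

Analysis/FluidPDE support file (all results proved; no definitions, no named facts). It serves
the discharge of the BDSV time-regularity step `Literature.Analysis.FluidPDE.BDSV.timeRegularity`
(`FluidPDE/OnsagerBDSVProofs`), which needs the Euler–Reynolds system
`∂ₜv + div(v ⊗ v) + ∇p = div R̊`, `div v = 0` (Buckmaster–De Lellis–Székelyhidi–Vicol 2019, (2.2))
and its pressure equation `Δp = div div(-v ⊗ v + R̊)` (BDSV 2019, §2.2) in coordinates on the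
periodic lift to `ℝ^d = EuclideanSpace ℝ d`, where the heat kernel acts.

## Main results

* Coordinates on `ℝ^d` (standard basis `eᵢ = EuclideanSpace.single i 1`):
  `div w = Σᵢ ∂ᵢwᵢ` (`divergence_eq_sum_fderiv_coord`), the conservation form of the convective
  derivative of a divergence-free field `((u·∇)u)ᵢ = Σⱼ ∂ⱼ(uᵢuⱼ)` (`convect_apply_eq_sum_fderiv_mul`)
  and `div((u·∇)u) = Σᵢⱼ ∂ᵢ∂ⱼ(uᵢuⱼ)` (`divergence_convect_eq_sum_sum`); the lifted tensor
  divergence `((div S)~)ᵢ = Σⱼ ∂ⱼ S̃ⱼᵢ` and `div (div S)~ = Σᵢⱼ ∂ᵢ∂ⱼ S̃ⱼᵢ`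
  (`lift_tensorDivergence_apply`, `divergence_lift_tensorDivergence`); components of gradients and
  the lift of the convective derivative (`lift_gradient_apply`, `lift_convect`,
  `lift_convect_apply_eq_sum`).
* `IsEulerReynoldsOn.isClassicalNSSolutionOn_lift`: the periodic lift of a classical
  Euler–Reynolds solution on `T^d × S` is a classical solution of the incompressible Euler
  equations on `ℝ^d × S` (`IsClassicalNSSolutionOn S 0`) with force `(div R̊)~` (the analogue for
  Euler–Reynolds triples of the undischarged bridge `IsClassicalNSSolutionOn.of_torus`).
* `IsEulerReynoldsOn.laplacian_lift_pressure`: **the pressure equation**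
  `Δp̃(t) = Σᵢⱼ ∂ᵢ∂ⱼ(R̊ⱼᵢ)~ - Σᵢⱼ ∂ᵢ∂ⱼ(vᵢvⱼ)~` at interior times (from
  `laplacian_pressure_eq_of_isClassicalNSSolutionOn`, `FluidPDE/PressurePoisson`).
* `IsEulerReynoldsOn.deriv_lift_velocity_apply`: the momentum equation solved for `∂ₜv`, lifted,
  in coordinates, at interior times.

## References

* T. Buckmaster, C. De Lellis, L. Székelyhidi Jr., V. Vicol, *Onsager's conjecture for admissible
  weak solutions*, CPAM 72 (2019) = arXiv:1701.08678, §2.1 (2.2) (Euler–Reynolds system), §2.2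
  (the equation for the pressure, `Δp_q = div div(-v_q ⊗ v_q + R̊_q)`).
* A. J. Majda, A. L. Bertozzi, *Vorticity and Incompressible Flow* (CUP 2002), §1.2, (1.13)
  (pressure Poisson equation).
-/

noncomputable section

open MeasureTheory Set Filter Topology InnerProductSpace
open scoped Laplacian ContDiff

namespace Literature.Analysis.FluidPDE

namespace Torus

variable {d : Type*} [Fintype d] [DecidableEq d]

/-! ## Coordinates: divergence, convective derivative, gradient and tensor divergence -/

section Coordinates

omit [DecidableEq d] in
/-- Components of the Fréchet derivative: `(Dw(x) a)ᵢ = D(wᵢ)(x) a`. [folklore] -/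
theorem fderiv_apply_coord {w : EuclideanSpace ℝ d → EuclideanSpace ℝ d} {x : EuclideanSpace ℝ d}
    (hw : DifferentiableAt ℝ w x) (a : EuclideanSpace ℝ d) (i : d) :
    fderiv ℝ w x a i = fderiv ℝ (fun y => w y i) x a := by
  have h : (fun y => w y i) = (EuclideanSpace.proj i : EuclideanSpace ℝ d →L[ℝ] ℝ) ∘ w := rfl
  rw [h, ((EuclideanSpace.proj i).hasFDerivAt.comp x hw.hasFDerivAt).fderiv]
  rfl

/-- **The divergence in coordinates**: `div w (x) = Σᵢ ∂ᵢ wᵢ (x)` with `∂ᵢ` the derivative along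
the standard basis vector `eᵢ` of `ℝ^d`. [folklore] -/
theorem divergence_eq_sum_fderiv_coord {w : EuclideanSpace ℝ d → EuclideanSpace ℝ d}
    {x : EuclideanSpace ℝ d} (hw : DifferentiableAt ℝ w x) :
    VectorCalculus.divergence w x =
      ∑ i, fderiv ℝ (fun y => w y i) x (EuclideanSpace.single i (1 : ℝ)) := by
  rw [divergence_eq_sum_inner_fderiv (EuclideanSpace.basisFun d ℝ) w x]
  refine Finset.sum_congr rfl fun i _ => ?_
  rw [EuclideanSpace.basisFun_apply, EuclideanSpace.inner_single_left, ← fderiv_apply_coord hw]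
  simp

/-- **The convective derivative in conservation form**: for a divergence-free `C¹` field `u`,
`((u·∇)u)ᵢ = Σⱼ ∂ⱼ (uᵢ uⱼ)` (Leibniz rule and `Σⱼ ∂ⱼuⱼ = 0`; BDSV write the Euler–Reynolds system
with `div (v ⊗ v)`). [cite: BuckmasterEtAl2018, §2.1] -/
theorem convect_apply_eq_sum_fderiv_mul {u : EuclideanSpace ℝ d → EuclideanSpace ℝ d}
    (hu : ContDiff ℝ 1 u) (hdiv : VectorCalculus.IsDivFree u) (y : EuclideanSpace ℝ d) (i : d) :
    convect u u y i = ∑ j, fderiv ℝ (fun z => u z i * u z j) y (EuclideanSpace.single j (1 : ℝ)) := by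
  have hud : Differentiable ℝ u := hu.differentiable one_ne_zero
  have hci : ∀ k, DifferentiableAt ℝ (fun z => u z k) y := fun k =>
    ((EuclideanSpace.proj k : EuclideanSpace ℝ d →L[ℝ] ℝ).differentiableAt).comp y (hud y)
  have hdiv' : ∑ j, fderiv ℝ (fun z => u z j) y (EuclideanSpace.single j (1 : ℝ)) = 0 := by
    rw [← divergence_eq_sum_fderiv_coord (hud y)]
    exact hdiv y
  -- right-hand side: Leibniz
  have hR : ∑ j, fderiv ℝ (fun z => u z i * u z j) y (EuclideanSpace.single j (1 : ℝ)) =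
      ∑ j, u y j * fderiv ℝ (fun z => u z i) y (EuclideanSpace.single j (1 : ℝ)) +
        u y i * ∑ j, fderiv ℝ (fun z => u z j) y (EuclideanSpace.single j (1 : ℝ)) := by
    rw [Finset.mul_sum, ← Finset.sum_add_distrib]
    refine Finset.sum_congr rfl fun j _ => ?_
    rw [fderiv_fun_mul (hci i) (hci j)]
    simp only [_root_.add_apply, _root_.FunLike.coe_smul, Pi.smul_apply, smul_eq_mul]
    ring
  rw [hR, hdiv', mul_zero, add_zero]
  -- left-hand side: expand `u y` in the standard basis
  rw [convect_apply, fderiv_apply_coord (hud y)]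
  conv_lhs => rw [← (EuclideanSpace.basisFun d ℝ).sum_repr (u y)]
  rw [map_sum]
  refine Finset.sum_congr rfl fun j _ => ?_
  rw [map_smul, EuclideanSpace.basisFun_repr, EuclideanSpace.basisFun_apply, smul_eq_mul]

/-- **Divergence of the convective derivative**: for a divergence-free `C²` field `u`,
`div((u·∇)u) = Σᵢ Σⱼ ∂ᵢ∂ⱼ (uᵢ uⱼ)` (the right-hand side of the pressure Poisson equation,
Majda–Bertozzi (1.13); BDSV (2.3) `Δp = div div (v ⊗ v)` up to sign conventions). [cite: BuckmasterEtAl2018, §2.2] -/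
theorem divergence_convect_eq_sum_sum {u : EuclideanSpace ℝ d → EuclideanSpace ℝ d}
    (hu : ContDiff ℝ 2 u) (hdiv : VectorCalculus.IsDivFree u) (x : EuclideanSpace ℝ d) :
    VectorCalculus.divergence (convect u u) x =
      ∑ i, ∑ j, fderiv ℝ (fun y => fderiv ℝ (fun z => u z i * u z j) y (EuclideanSpace.single j (1 : ℝ)))
        x (EuclideanSpace.single i (1 : ℝ)) := by
  have hu1 : ContDiff ℝ 1 u := hu.of_le one_le_two
  have hud : Differentiable ℝ u := hu1.differentiable one_ne_zero
  have hci : ∀ k, ContDiff ℝ 2 (fun z => u z k) := fun k =>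
    (EuclideanSpace.proj k : EuclideanSpace ℝ d →L[ℝ] ℝ).contDiff.comp hu
  have hcd : DifferentiableAt ℝ (convect u u) x := by
    have : convect u u = fun y => fderiv ℝ u y (u y) := rfl
    rw [this]
    exact (((hu.fderiv_right (m := 1) le_rfl).differentiable one_ne_zero).clm_apply hud) x
  rw [divergence_eq_sum_fderiv_coord hcd]
  refine Finset.sum_congr rfl fun i _ => ?_
  have hfun : (fun y => convect u u y i) =
      fun y => ∑ j, fderiv ℝ (fun z => u z i * u z j) y (EuclideanSpace.single j (1 : ℝ)) :=
    funext fun y => convect_apply_eq_sum_fderiv_mul hu1 hdiv y i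
  have hdj : ∀ j, DifferentiableAt ℝ
      (fun y => fderiv ℝ (fun z => u z i * u z j) y (EuclideanSpace.single j (1 : ℝ))) x := fun j =>
    ((((hci i).mul (hci j)).fderiv_right (m := 1) le_rfl).differentiable one_ne_zero).clm_apply
      (differentiable_const _) x
  rw [hfun, fderiv_fun_sum fun j _ => hdj j, _root_.FunLike.coe_sum, Finset.sum_apply]

variable {F : Type*} [NormedAddCommGroup F] [NormedSpace ℝ F]

/-- The lift of a partial derivative of a smooth torus function is the coordinate derivative of
the lift: `(∂ⱼ f)~ (y) = D f̃ (y) eⱼ`. [folklore] -/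
theorem lift_partialDeriv_apply {f : UnitAddTorus d → F} (hf : FunctionSpaces.Torus.IsSmooth f) (j : d)
    (y : EuclideanSpace ℝ d) :
    FunctionSpaces.Torus.lift (FunctionSpaces.Torus.partialDeriv j f) y =
      fderiv ℝ (FunctionSpaces.Torus.lift f) y (EuclideanSpace.single j (1 : ℝ)) := by
  unfold FunctionSpaces.Torus.partialDeriv
  rw [FunctionSpaces.Torus.lift_lineDeriv (hf.isContDiff (by simp))]

/-- **The tensor divergence in coordinates, lifted**: for a smooth tensor field `S` on `T^d`
(columns `S x j`), `((div S)~ (y))ᵢ = Σⱼ D (S̃ⱼᵢ)(y) eⱼ` with `S̃ⱼᵢ = (x ↦ S x j i)~`. [folklore] -/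
theorem lift_tensorDivergence_apply {S : UnitAddTorus d → d → EuclideanSpace ℝ d}
    (hS : FunctionSpaces.Torus.IsSmooth S) (y : EuclideanSpace ℝ d) (i : d) :
    FunctionSpaces.Torus.lift (tensorDivergence S) y i =
      ∑ j, fderiv ℝ (FunctionSpaces.Torus.lift (fun x => S x j i)) y (EuclideanSpace.single j (1 : ℝ)) := by
  rw [FunctionSpaces.Torus.lift_apply, tensorDivergence]
  rw [show (∑ j, FunctionSpaces.Torus.partialDeriv j (fun y => S y j) (FunctionSpaces.Torus.proj y)) i =
      ∑ j, FunctionSpaces.Torus.partialDeriv j (fun y => S y j) (FunctionSpaces.Torus.proj y) i by simp]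
  refine Finset.sum_congr rfl fun j _ => ?_
  have h1 : FunctionSpaces.Torus.partialDeriv j (fun y => S y j) (FunctionSpaces.Torus.proj y) =
      fderiv ℝ (FunctionSpaces.Torus.lift (fun x => S x j)) y (EuclideanSpace.single j (1 : ℝ)) := by
    rw [← lift_partialDeriv_apply (hS.column j)]
    rfl
  have hd : DifferentiableAt ℝ (FunctionSpaces.Torus.lift (fun x => S x j)) y :=
    ((hS.column j).isContDiff (n := 1) (by simp)).differentiable one_ne_zero y
  rw [h1, fderiv_apply_coord hd]
  rfl

/-- **Divergence of the lifted tensor divergence**: `div ((div S)~) = Σᵢ Σⱼ ∂ᵢ∂ⱼ S̃ⱼᵢ`. [folklore] -/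
theorem divergence_lift_tensorDivergence {S : UnitAddTorus d → d → EuclideanSpace ℝ d}
    (hS : FunctionSpaces.Torus.IsSmooth S) (x : EuclideanSpace ℝ d) :
    VectorCalculus.divergence (FunctionSpaces.Torus.lift (tensorDivergence S)) x =
      ∑ i, ∑ j, fderiv ℝ (fun y => fderiv ℝ (FunctionSpaces.Torus.lift (fun x => S x j i)) y
        (EuclideanSpace.single j (1 : ℝ))) x (EuclideanSpace.single i (1 : ℝ)) := by
  have hsm : FunctionSpaces.Torus.IsSmooth (tensorDivergence S) := hS.tensorDivergence
  have hd : DifferentiableAt ℝ (FunctionSpaces.Torus.lift (tensorDivergence S)) x :=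
    (hsm.isContDiff (n := 1) (by simp)).differentiable one_ne_zero x
  rw [divergence_eq_sum_fderiv_coord hd]
  refine Finset.sum_congr rfl fun i _ => ?_
  have hfun : (fun y => FunctionSpaces.Torus.lift (tensorDivergence S) y i) = fun y =>
      ∑ j, fderiv ℝ (FunctionSpaces.Torus.lift (fun x => S x j i)) y (EuclideanSpace.single j (1 : ℝ)) :=
    funext fun y => lift_tensorDivergence_apply hS y i
  have hji : ∀ j, FunctionSpaces.Torus.IsSmooth (fun x => S x j i) := fun j => (hS.column j).apply i
  have hdj : ∀ j, DifferentiableAt ℝ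
      (fun y => fderiv ℝ (FunctionSpaces.Torus.lift (fun x => S x j i)) y (EuclideanSpace.single j (1 : ℝ))) x :=
    fun j => (((hji j).fderiv_right (m := ∞) le_rfl).differentiable (by simp)).clm_apply
      (differentiable_const _) x
  rw [hfun, fderiv_fun_sum fun j _ => hdj j, _root_.FunLike.coe_sum, Finset.sum_apply]

/-- Components of the gradient of a scalar function on `ℝ^d`: `(∇g(y))ᵢ = Dg(y) eᵢ`. [folklore] -/
theorem gradient_apply_coord (g : EuclideanSpace ℝ d → ℝ) (y : EuclideanSpace ℝ d) (i : d) :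
    gradient g y i = fderiv ℝ g y (EuclideanSpace.single i (1 : ℝ)) := by
  have h := EuclideanSpace.inner_single_left i (1 : ℝ) (gradient g y)
  simp only [map_one, one_mul] at h
  rw [← h, real_inner_comm, gradient, InnerProductSpace.toDual_symm_apply]

omit [DecidableEq d] in
/-- The lift of the torus gradient is the gradient of the lift (twin of `Torus.fderiv_lift`; the
same statement as `FunctionSpaces.Torus.gradient_lift` of `TorusPeriodization`, not imported
here). [folklore] -/
theorem lift_gradient_eq (θ : UnitAddTorus d → ℝ) (y : EuclideanSpace ℝ d) :
    FunctionSpaces.Torus.lift (FunctionSpaces.Torus.gradient θ) y =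
      gradient (FunctionSpaces.Torus.lift θ) y := by
  rw [FunctionSpaces.Torus.lift_apply, FunctionSpaces.Torus.gradient, _root_.gradient, _root_.gradient,
    FunctionSpaces.Torus.fderiv_lift]
  rfl

/-- The lift of the torus gradient in coordinates: `((∇θ)~ (y))ᵢ = D θ̃ (y) eᵢ`. [folklore] -/
theorem lift_gradient_apply (θ : UnitAddTorus d → ℝ) (y : EuclideanSpace ℝ d) (i : d) :
    FunctionSpaces.Torus.lift (FunctionSpaces.Torus.gradient θ) y i =
      fderiv ℝ (FunctionSpaces.Torus.lift θ) y (EuclideanSpace.single i (1 : ℝ)) := by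
  rw [lift_gradient_eq, gradient_apply_coord]

omit [DecidableEq d] in
/-- The lift of the convective derivative: `((u·∇)w)~ = (ũ·∇)w̃`. [folklore] -/
theorem lift_convect {F' : Type*} [NormedAddCommGroup F'] [InnerProductSpace ℝ F']
    (u : UnitAddTorus d → EuclideanSpace ℝ d) (w : UnitAddTorus d → F') :
    FunctionSpaces.Torus.lift (FunctionSpaces.Torus.convect u w) =
      convect (FunctionSpaces.Torus.lift u) (FunctionSpaces.Torus.lift w) := by
  funext y
  rw [FunctionSpaces.Torus.lift_apply, FunctionSpaces.Torus.convect, convect_apply,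
    FunctionSpaces.Torus.fderiv_lift, FunctionSpaces.Torus.lift_apply]

/-- The lift of the convective derivative of a divergence-free smooth torus field in conservation
form: `(((v·∇)v)~ (y))ᵢ = Σⱼ D((vᵢvⱼ)~)(y) eⱼ`. [cite: BuckmasterEtAl2018, §2.1] -/
theorem lift_convect_apply_eq_sum {v : UnitAddTorus d → EuclideanSpace ℝ d}
    (hv : FunctionSpaces.Torus.IsSmooth v) (hdiv : FunctionSpaces.Torus.IsDivFree v)
    (y : EuclideanSpace ℝ d) (i : d) :
    FunctionSpaces.Torus.lift (FunctionSpaces.Torus.convect v v) y i =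
      ∑ j, fderiv ℝ (FunctionSpaces.Torus.lift (fun x => v x i * v x j)) y (EuclideanSpace.single j (1 : ℝ)) := by
  rw [lift_convect]
  have hv1 : FunctionSpaces.Torus.IsContDiff 1 v := hv.isContDiff (by simp)
  have hdiv' : VectorCalculus.IsDivFree (FunctionSpaces.Torus.lift v) :=
    (FunctionSpaces.Torus.isDivFree_iff_trace_fderiv_lift hv1).1 hdiv
  exact convect_apply_eq_sum_fderiv_mul hv1 hdiv' y i

end Coordinates

/-! ## Lifting an Euler–Reynolds solution to `ℝ^d`; the pressure equation -/

section Pressure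

variable {S : Set ℝ} {v : ℝ → UnitAddTorus d → EuclideanSpace ℝ d} {p : ℝ → UnitAddTorus d → ℝ}
  {R : ℝ → UnitAddTorus d → d → EuclideanSpace ℝ d}

/-- **Torus-to-space bridge for Euler–Reynolds solutions.** The periodic lift of a classical
Euler–Reynolds solution on `T^d × S` is a classical (periodic) solution of the incompressible
Euler equations on `ℝ^d × S` (`IsClassicalNSSolutionOn` with `ν = 0`) forced by the lifted stress
divergence `f = (div R̊)~`: `∂ₜṽ + (ṽ·∇)ṽ = -∇p̃ + (div R̊)~`, `div ṽ = 0` (Fefferman (8), (10):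
periodic solutions on `ℝⁿ`; BDSV (2.2)). Smoothness is definitional, the operators agree by
`Torus.fderiv_lift`. [cite: BuckmasterEtAl2018, §2.1] -/
theorem IsEulerReynoldsOn.isClassicalNSSolutionOn_lift (h : IsEulerReynoldsOn S v p R) :
    IsClassicalNSSolutionOn S 0 (fun t => FunctionSpaces.Torus.lift (tensorDivergence (R t)))
      (fun t => FunctionSpaces.Torus.lift (v t)) (fun t => FunctionSpaces.Torus.lift (p t)) where
  smooth_velocity := isSmoothSpaceTimeOn_iff_torus.2 h.smooth_velocity
  smooth_pressure := isSmoothSpaceTimeOn_iff_torus.2 h.smooth_pressure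
  momentum t ht y := by
    have hm := h.momentum t ht (FunctionSpaces.Torus.proj y)
    rw [timeDerivWithin_lift, ← lift_convect, FunctionSpaces.Torus.lift_apply,
      ← lift_gradient_eq, FunctionSpaces.Torus.lift_apply, FunctionSpaces.Torus.lift_apply, zero_smul,
      zero_sub, ← hm]
    abel
  divFree t ht := (FunctionSpaces.Torus.isDivFree_iff_trace_fderiv_lift
    ((h.smooth_velocity.isSmooth_slice ht).isContDiff (by simp))).1 (h.divFree t ht)

/-- **The pressure equation of an Euler–Reynolds solution, lifted to `ℝ^d`** (BDSV 2019, §2.2,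
display (2.5)/(e:press): `Δp_q = div div (-v_q ⊗ v_q + R̊_q)`). At every interior time `t` of `S`
and every `y ∈ ℝ^d`,
`Δp̃(t)(y) = Σᵢⱼ ∂ᵢ∂ⱼ (R̊ⱼᵢ)~ (y) - Σᵢⱼ ∂ᵢ∂ⱼ (vᵢvⱼ)~ (y)`
(divergence of the momentum equation, `div ∂ₜv = 0`, `div ∇p = Δp`, via
`laplacian_pressure_eq_of_isClassicalNSSolutionOn` for the lifted solution). [cite: BuckmasterEtAl2018, §2.2 (the equation for the pressure)] -/
theorem IsEulerReynoldsOn.laplacian_lift_pressure (h : IsEulerReynoldsOn S v p R) {t : ℝ}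
    (ht : t ∈ interior S) (y : EuclideanSpace ℝ d) :
    (Δ (FunctionSpaces.Torus.lift (p t))) y =
      ∑ i, ∑ j, fderiv ℝ (fun z => fderiv ℝ (FunctionSpaces.Torus.lift (fun x => R t x j i)) z
          (EuclideanSpace.single j (1 : ℝ))) y (EuclideanSpace.single i (1 : ℝ)) -
      ∑ i, ∑ j, fderiv ℝ (fun z => fderiv ℝ (FunctionSpaces.Torus.lift (fun x => v t x i * v t x j)) z
          (EuclideanSpace.single j (1 : ℝ))) y (EuclideanSpace.single i (1 : ℝ)) := by
  have ht' : t ∈ S := interior_subset ht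
  have hv : FunctionSpaces.Torus.IsSmooth (v t) := h.smooth_velocity.isSmooth_slice ht'
  have hR : FunctionSpaces.Torus.IsSmooth (R t) := h.smooth_stress.isSmooth_slice ht'
  have hv2 : ContDiff ℝ 2 (FunctionSpaces.Torus.lift (v t)) := hv.isContDiff (n := 2)
    (WithTop.coe_le_coe.mpr le_top)
  have hdiv : VectorCalculus.IsDivFree (FunctionSpaces.Torus.lift (v t)) :=
    (FunctionSpaces.Torus.isDivFree_iff_trace_fderiv_lift (hv.isContDiff (by simp))).1 (h.divFree t ht')
  rw [laplacian_pressure_eq_of_isClassicalNSSolutionOn h.isClassicalNSSolutionOn_lift ht y,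
    divergence_convect_eq_sum_sum hv2 hdiv, divergence_lift_tensorDivergence hR, neg_add_eq_sub]
  rfl

/-- **The momentum equation solved for `∂ₜv`, lifted, in coordinates** (interior times): for
`t ∈ interior S`, `y ∈ ℝ^d` and a coordinate `i`,
`∂ₜṽᵢ(t, y) = Σⱼ ∂ⱼ(R̊ⱼᵢ)~(y) - ∂ᵢ p̃(t)(y) - Σⱼ ∂ⱼ (vᵢvⱼ)~(y)`. [cite: BuckmasterEtAl2018, §2.1] -/
theorem IsEulerReynoldsOn.deriv_lift_velocity_apply (h : IsEulerReynoldsOn S v p R) {t : ℝ}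
    (ht : t ∈ interior S) (y : EuclideanSpace ℝ d) (i : d) :
    deriv (fun s => FunctionSpaces.Torus.lift (v s) y) t i =
      ∑ j, fderiv ℝ (FunctionSpaces.Torus.lift (fun x => R t x j i)) y (EuclideanSpace.single j (1 : ℝ)) -
      fderiv ℝ (FunctionSpaces.Torus.lift (p t)) y (EuclideanSpace.single i (1 : ℝ)) -
      ∑ j, fderiv ℝ (FunctionSpaces.Torus.lift (fun x => v t x i * v t x j)) y
        (EuclideanSpace.single j (1 : ℝ)) := by
  have ht' : t ∈ S := interior_subset ht
  have hv : FunctionSpaces.Torus.IsSmooth (v t) := h.smooth_velocity.isSmooth_slice ht'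
  have hR : FunctionSpaces.Torus.IsSmooth (R t) := h.smooth_stress.isSmooth_slice ht'
  have hm := h.momentum t ht' (FunctionSpaces.Torus.proj y)
  rw [FunctionSpaces.Torus.timeDerivWithin_of_mem_interior ht] at hm
  have hd : deriv (fun s => FunctionSpaces.Torus.lift (v s) y) t =
      FunctionSpaces.Torus.lift (tensorDivergence (R t)) y -
        FunctionSpaces.Torus.lift (FunctionSpaces.Torus.gradient (p t)) y -
        FunctionSpaces.Torus.lift (FunctionSpaces.Torus.convect (v t) (v t)) y := by
    simp only [FunctionSpaces.Torus.lift_apply]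
    rw [← hm, FunctionSpaces.Torus.timeDeriv]
    abel
  rw [hd, PiLp.sub_apply, PiLp.sub_apply, lift_tensorDivergence_apply hR, lift_gradient_apply,
    lift_convect_apply_eq_sum hv (h.divFree t ht')]

end Pressure

end Torus

end Literature.Analysis.FluidPDE
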